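import Mathlib
import Literature.NumberTheory.LFunctions.RiemannXi
import Literature.NumberTheory.LFunctions.RiemannXiProofs
import Literature.NumberTheory.LFunctions.GeneralizedRH
import Summits.RiemannHypothesis.RiemannHypothesis.Theses.RuelleBand
import HarnessLib.Audit

/-!
# Line `rate-band-collar-split` — skeleton for crux `RuelleBand.CofiniteCriticalLine`
(item stmt-RiemannHypothesis-2064, route route-RiemannHypothesis-RuelleBand; crux idea card
`Cruxes/CofiniteCriticalLine/Ideas/rate-band-collar-split.md` (ideator 3, sketch `SketchIdeator3.lean`);
triage r1-1 / r1-2 / r1-3: pass, with the sharpening "constant junction only; near stub =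
fixed-collar monotonicity for ONE width; record the NearRH glue; park behind the band engine")

Crux (by name, never restated): `CofiniteCriticalLine` — the set of zeros of `ζ` in the open strip
off the critical line is finite ("RH above some height", landed Negative lemma
`Negative.cofiniteCriticalLine_iff_eventually_on_line`, re-proved here as `cofinite_iff_exists_onLineAbove`).

THE LINE (one lever: cut the crux EXACTLY along a collar of the critical line).
For a width function `η` the crux splits as FAR ∧ NEAR:
* FAR  `RateBandW η T₁`  — every zero of height `|Im s| ≥ T₁` lies within `η |Im s|` of the line;
* NEAR `CollarMonoW η T₂` — for `|t| ≥ T₂` the horizontal modulus profile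
  `x ↦ |ξ(1/2 + x + it)|` is nondecreasing on the collar `0 ≤ x ≤ η |t|`.
The composition FAR ∧ NEAR ⇒ "RH above height max T₁ T₂" ⇒ crux is PROVED below for every `η`
(`onLineAbove_of_rateBandW_of_collarMonoW`: a zero at offset `0 < x₀ ≤ η|t|` makes the monotone
nonnegative profile vanish on the segment `[0, x₀]`, and the identity theorem for the entire `ξ`
with `ξ(0) = 1/2` forbids that — `re_eq_half_of_monotoneOn`, the near mechanism isolated at ONE height);
the converse (crux ⇒ FAR ∧ NEAR at every width) is the Hadamard partial fraction
`Re ξ'/ξ(s) = Σ Re 1/(s−ρ)` (tree: `IsHadamardSeq.re_logDeriv_riemannXi_eq_tsum`), so NOTHING is lost.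

REGISTERED CUT = the CONSTANT junction `η ≡ ε₀` (triage consensus): then FAR is exactly the eventual
form of the route's own rung #4 `AsymptoticCriticalLine` (item stmt-RiemannHypothesis-2063, SHARED — the
line consumes rung #4, it does not re-prove it: `stub_far`), and NEAR is eventual Sondow–Dumitrescu /
Matiyasevich–Saidak–Zvengrowski monotonicity of `|ξ|` on a collar of FIXED width, for one `ε₀ > 0`
(`stub_near`) — the typed residue `#5 ∖ #4`. `CofiniteCriticalLine_of` concludes the crux BY NAME from
the two stubs (sorry-free apart from the stubs). Glue recorded for the lead (triage r1-1/r1-2):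
`nearOnLine_of_fixedCollar` (the ONLY property of `stub_near` consumed is "no zero with
`0 < |re s − 1/2| ≤ ε₀` above `T`") and `cofinite_iff_exists_nearOnLine_of_asymptotic`
(given rung #4, crux ⟺ ∃ T, NearOnLine ε₀ T): modulo `stub_far` the near stub is the crux near the line,
in monotone clothing — its value is the ALLOCATION (far = band engine; near = kernel-side / Laguerre /
certified-numerics habitat of `|ξ(1/2+x+it)|² = Σ L_n(t) x^{2n}`), not a drop in strength.

WHY NOT A THINNER COLLAR (polynomial `η = C t^{-ε}` or logarithmic `η = κ/log t`, both members of the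
family below): any `η → 0` makes FAR imply rung #4 outright and asks the band engine for a RATE that no
engine is conjectured to output (triage r1-3; FT2021 §7 reading ungrounded), while the near half's only
finite-order tool, a quantitative first Laguerre inequality `L₁(t) ≥ Σ_{n≥2} n|L_n(t)| η^{2n-2}` (first term
dominates the derivative tail at the collar edge), is NOT RH-IMPLIED at width `η = κ/log t`, hence no sane target:
under RH, midway between consecutive zeros at distance `g` the normalised coefficients are `e₁ ≈ 8/g²`,
`e₂ ≥ 16/g⁴`, so the inequality needs `g ≥ 2η(1+o(1))`, i.e. normalised gap `≥ κ/π`; under RH normalised gaps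
below `0.52` occur infinitely often (small-gap theorems of Bui–Milinovich / Feng–Wu / Preobrazhenskii), so it
fails infinitely often for `κ > 0.52π`, and for EVERY `κ > 0` under Montgomery's pair-correlation conjecture
(`μ = 0`). Only all-orders positivity `∀ n, L_n(t) ≥ 0 (|t| ≥ T)` survives, and that is crux-EQUIVALENT
(coefficients of the Hadamard product: a quadruple's factor `x⁴ + 2x²(D² − a²) + (a² + D²)²` is coefficientwise
nonnegative iff `D² ≥ a²`) — the crux restated (obstruction note R1), not cut.
So the constant junction is the honest registration; the general-`η` composition stays available (proved).

DISPROOF HONOURED (`Cruxes/CofiniteCriticalLine/Disproof.lean`, cdisprove cycle 1; landed copies under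
`Theorems/CofiniteCriticalLine/Negative/`): `cofiniteCriticalLine_false_without_neHalf` (Hardy) — the
conjunct `s.re ≠ 1/2` is used in `re_eq_half_of_monotoneOn` (the vanishing segment `[0, x₀]` is
NON-DEGENERATE only because `x₀ ≠ 0`); `…_false_without_rePos` / `…_false_without_zeta` — both stubs
quantify over zeros of `ζ` in the OPEN strip only (`riemannXi_eq_zero_iff_holds` converts); `…_iff_without_ltOne`
— `s.re < 1` enters only through that conversion; §4(a) `not_abstract_asymptotic_imp_cofinite` (rung-#4 SHAPE
⇏ rung-#5 shape, witness `1/2 + 1/(n+2) + n i`) — respected: the witness sits in the NEAR half (collar zeros at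
every large height) and `CofiniteCriticalLine_of` uses analyticity of `ξ` + `ξ(0) = 1/2`, not the shape of
the zero set; §1 `cofiniteCriticalLine_iff_eventually_on_line` is the glue (re-proved verbatim as
`cofinite_iff_exists_onLineAbove`; landed copy in `Negative.Reformulations`); §6 (KKL at `t = 0`) is the TEMPLATE of the near half (Hermite–Biehler step of
`ki_kim_lee_finite_of_strictMonoOn_xiHeatRay` at heat time 0), not used logically.
`ledger negatives --problem RiemannHypothesis`: no refuted statement is restated by a stub (checked at filing).

Stub signatures are written over Mathlib + `Literature.NumberTheory.LFunctions.riemannXi` + the route decl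
only (no local definition inside a stub type), so each can land as a pure-proof helper (`--supports`).
-/

noncomputable section

set_option linter.dupNamespace false

open Complex Set
open scoped ComplexConjugate

namespace Summit.RiemannHypothesis.RiemannHypothesis.Cruxes.CofiniteCriticalLine.RateBandCollarSplit

open Literature.NumberTheory.LFunctions
open Summit.RiemannHypothesis.RiemannHypothesis.Theses.RuelleBand

/-! ### §1 Dictionary: the one-parameter family of exact splits -/

/-- FAR half with width function `η` ("band with a rate"): every zero of `ζ` in the open strip of
height `|Im s| ≥ T₁` lies within `η |Im s|` of the critical line.  `η ≡ ε₀` is the eventual form of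
rung #4 at one width; `η t = C t^{-ε}` is the ideator's `RateBand ε C`; `η t = κ / log t` the
logarithmic junction. RH-implied for `η ≥ 0`. -/
def RateBandW (η : ℝ → ℝ) (T₁ : ℝ) : Prop :=
  ∀ s : ℂ, riemannZeta s = 0 → 0 < s.re → s.re < 1 → T₁ ≤ |s.im| → |s.re - 1 / 2| ≤ η |s.im|

/-- NEAR half with width function `η` ("collar monotonicity"): for `|t| ≥ T₂` the horizontal modulus
profile `x ↦ |ξ(1/2 + x + it)|` is nondecreasing on the collar `0 ≤ x ≤ η |t|`.  RH-implied (under RH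
`|ξ(1/2+x+it)|² = ξ(1/2)² ∏ₖ ((γₖ−t)²+x²)((γₖ+t)²+x²)/γₖ⁴`, each factor increasing in `x ≥ 0`). -/
def CollarMonoW (η : ℝ → ℝ) (T₂ : ℝ) : Prop :=
  ∀ t : ℝ, T₂ ≤ |t| → MonotoneOn (fun x : ℝ => ‖riemannXi (1 / 2 + x + t * I)‖) (Icc 0 (η |t|))

/-- "RH above height `T`": every zero of `ζ` in the open strip with `|Im s| > T` is on the line
(the right-hand side of `cofinite_iff_exists_onLineAbove`). -/
def OnLineAbove (T : ℝ) : Prop :=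
  ∀ s : ℂ, riemannZeta s = 0 → 0 < s.re → s.re < 1 → T < |s.im| → s.re = 1 / 2

/-- Fixed-width collar monotonicity (the constant member `η ≡ ε₀` of `CollarMonoW`). -/
def FixedCollar (ε₀ T : ℝ) : Prop :=
  ∀ t : ℝ, T ≤ |t| → MonotoneOn (fun x : ℝ => ‖riemannXi (1 / 2 + x + t * I)‖) (Icc 0 ε₀)

/-- "RH near the line above height `T`": no zero of `ζ` with `0 < |re s − 1/2| ≤ ε₀` and `|Im s| > T`.
This is the ONLY consequence of `FixedCollar ε₀ T` that the composition consumes (triage r1-1/r1-2). -/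
def NearOnLine (ε₀ T : ℝ) : Prop :=
  ∀ s : ℂ, riemannZeta s = 0 → 0 < s.re → s.re < 1 → T < |s.im| → |s.re - 1 / 2| ≤ ε₀ → s.re = 1 / 2

theorem collarMonoW_const_iff (ε₀ T : ℝ) : CollarMonoW (fun _ => ε₀) T ↔ FixedCollar ε₀ T := Iff.rfl

/-- GLUE 0 = the standing disprover's `cofiniteCriticalLine_iff_eventually_on_line` (Disproof §1; landed as
`Summit.RiemannHypothesis.Cruxes.CofiniteCriticalLine.cofinite_iff_exists_onLineAbove` in
`Theorems/CofiniteCriticalLine/Negative/Reformulations.lean`), re-proved verbatim here so that this file elaborates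
without that module: crux ⟺ "RH above some height" (finitely many exceptions ⟺ exceptions of bounded height, by
Mathlib `IsCompact.inter_riemannZetaZeros_finite`). -/
theorem cofinite_iff_exists_onLineAbove : CofiniteCriticalLine ↔ ∃ T : ℝ, OnLineAbove T := by
  constructor
  · intro h
    obtain ⟨T, hT⟩ := (Set.Finite.image (fun s : ℂ => |s.im|) h).bddAbove
    refine ⟨T, fun s hz h0 h1 hT' => ?_⟩
    by_contra hne
    have : |s.im| ≤ T := hT ⟨s, ⟨hz, h0, h1, hne⟩, rfl⟩
    linarith
  · rintro ⟨T, hT⟩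
    refine (((isCompact_Icc (a := (0 : ℝ)) (b := 1)).reProdIm
      (isCompact_Icc (a := -T) (b := T))).inter_riemannZetaZeros_finite).subset ?_
    rintro s ⟨hz, h0, h1, hne⟩
    have him : |s.im| ≤ T := not_lt.1 fun h => hne (hT s hz h0 h1 h)
    exact ⟨Complex.mem_reProdIm.2 ⟨⟨h0.le, h1.le⟩, abs_le.1 him⟩, hz⟩

/-! ### §2 The near mechanism at ONE height: a collar zero makes `|ξ|` vanish on a segment -/

/-- If the profile at height `t` is nondecreasing on `[0, X]` and `ξ(1/2 + x₀ + it) = 0` with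
`0 < x₀ ≤ X`, contradiction: `|ξ| ≤ 0` on the segment `[0, x₀] + it`, so the entire function `ξ`
vanishes on a set accumulating at `1/2 + x₀ + it`, hence identically — but `ξ(0) = 1/2`. -/
theorem false_of_monotoneOn_of_xi_eq_zero {t X x₀ : ℝ}
    (hmono : MonotoneOn (fun x : ℝ => ‖riemannXi (1 / 2 + x + t * I)‖) (Icc 0 X))
    (hx₀ : 0 < x₀) (hx₀X : x₀ ≤ X) (hzero : riemannXi (1 / 2 + x₀ + t * I) = 0) : False := by
  set w : ℂ := 1 / 2 + x₀ + t * I with hw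
  -- every point of the horizontal segment `[1/2, 1/2 + x₀] + it` is a zero of `ξ`
  have hseg : ∀ x : ℝ, 0 ≤ x → x ≤ x₀ → riemannXi (1 / 2 + x + t * I) = 0 := by
    intro x hx hxx
    have hle : ‖riemannXi (1 / 2 + x + t * I)‖ ≤ ‖riemannXi (1 / 2 + x₀ + t * I)‖ :=
      hmono ⟨hx, hxx.trans hx₀X⟩ ⟨hx₀.le, hx₀X⟩ hxx
    rw [hzero, norm_zero] at hle
    exact norm_eq_zero.1 (le_antisymm hle (norm_nonneg _))
  have han : AnalyticAt ℂ riemannXi w := differentiable_riemannXi.analyticAt w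
  rcases han.eventually_eq_zero_or_eventually_ne_zero with hev | hev
  · have hall : EqOn riemannXi 0 univ :=
      AnalyticOnNhd.eqOn_zero_of_preconnected_of_eventuallyEq_zero
        (fun z _ => differentiable_riemannXi.analyticAt z) isPreconnected_univ (mem_univ w) hev
    have h00 := hall (mem_univ (0 : ℂ))
    rw [riemannXi_zero] at h00
    norm_num at h00
  · rw [eventually_nhdsWithin_iff, Metric.eventually_nhds_iff] at hev
    obtain ⟨δ, hδ, hδ'⟩ := hev
    set m : ℝ := min (δ / 2) x₀ with hm
    have hmpos : 0 < m := lt_min (by linarith) hx₀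
    have hmle : m ≤ x₀ := min_le_right _ _
    have hmle' : m ≤ δ / 2 := min_le_left _ _
    have hz' := hseg (x₀ - m) (by linarith) (by linarith)
    have hzpt : (1 / 2 : ℂ) + ((x₀ - m : ℝ) : ℂ) + (t : ℂ) * I = w - (m : ℂ) := by
      simp only [hw]; push_cast; ring
    have hdist : dist ((1 / 2 : ℂ) + ((x₀ - m : ℝ) : ℂ) + (t : ℂ) * I) w < δ := by
      rw [hzpt, dist_eq_norm, sub_sub_cancel_left, norm_neg, Complex.norm_real, Real.norm_eq_abs,
        abs_of_pos hmpos]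
      linarith
    have hne' : (1 / 2 : ℂ) + ((x₀ - m : ℝ) : ℂ) + (t : ℂ) * I ∈ ({w}ᶜ : Set ℂ) := by
      rw [mem_compl_singleton_iff, hzpt, Ne, sub_eq_self]
      exact_mod_cast hmpos.ne'
    exact hδ' hdist hne' hz'

/-- Right-half form: a zero of `ζ` with `1/2 < re s < 1`, `re s − 1/2 ≤ X`, at a height where the
profile is nondecreasing on `[0, X]`, is impossible. -/
theorem false_of_monotoneOn_of_zero_right {X : ℝ} {s : ℂ}
    (hmono : MonotoneOn (fun x : ℝ => ‖riemannXi (1 / 2 + x + s.im * I)‖) (Icc 0 X))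
    (hz : riemannZeta s = 0) (hgt : 1 / 2 < s.re) (h1 : s.re < 1) (hX : s.re - 1 / 2 ≤ X) : False := by
  set x₀ : ℝ := s.re - 1 / 2 with hx₀
  have hx₀pos : 0 < x₀ := by rw [hx₀]; linarith
  have hw_eq : (1 / 2 : ℂ) + ((x₀ : ℝ) : ℂ) + ((s.im : ℝ) : ℂ) * I = s := by
    apply Complex.ext
    · simp [hx₀]
    · simp
  have hξ : riemannXi (1 / 2 + ((x₀ : ℝ) : ℂ) + ((s.im : ℝ) : ℂ) * I) = 0 := by
    rw [hw_eq]
    exact (riemannXi_eq_zero_iff_holds s).2 ⟨hz, by linarith, h1⟩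
  exact false_of_monotoneOn_of_xi_eq_zero hmono hx₀pos hX hξ

/-- THE NEAR MECHANISM, both sides of the line: if the profile at height `im s` is nondecreasing on
`[0, X]`, then a zero `s` of `ζ` in the open strip with `|re s − 1/2| ≤ X` is ON the line.  A zero left
of the line is moved to the right at the SAME height by `s ↦ 1 − conj s` (Mathlib `riemannZeta_conj` +
the functional equation, tree lemma `GeneralizedRH.riemannZeta_one_sub_eq_zero`). This is where the
conjunct `re s ≠ 1/2` of the crux is load-bearing (`Disproof …_false_without_neHalf`): `x₀ = |re s − 1/2|`
must be positive for the segment to be non-degenerate. -/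
theorem re_eq_half_of_monotoneOn {X : ℝ} {s : ℂ}
    (hmono : MonotoneOn (fun x : ℝ => ‖riemannXi (1 / 2 + x + s.im * I)‖) (Icc 0 X))
    (hz : riemannZeta s = 0) (h0 : 0 < s.re) (h1 : s.re < 1) (hX : |s.re - 1 / 2| ≤ X) :
    s.re = 1 / 2 := by
  by_contra hne
  rcases lt_or_gt_of_ne hne with hlt | hgt
  · -- reflect to the right half at the same height: s' = 1 - conj s
    set s' : ℂ := 1 - conj s with hs'
    have hz' : riemannZeta s' = 0 := by
      have hc : riemannZeta (conj s) = 0 := by rw [riemannZeta_conj, hz, map_zero]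
      exact GeneralizedRH.riemannZeta_one_sub_eq_zero hc (by simpa using h0) (by simpa using h1)
    have hre' : s'.re = 1 - s.re := by simp [hs']
    have him' : s'.im = s.im := by simp [hs']
    have hX' : s'.re - 1 / 2 ≤ X := by
      rw [abs_of_neg (by linarith)] at hX
      rw [hre']; linarith
    refine false_of_monotoneOn_of_zero_right (s := s') ?_ hz' (by rw [hre']; linarith)
      (by rw [hre']; linarith) hX'
    rw [him']; exact hmono
  · rw [abs_of_pos (by linarith)] at hX
    exact false_of_monotoneOn_of_zero_right hmono hz hgt h1 hX

/-! ### §3 The general composition (every width function `η`): FAR ∧ NEAR ⇒ RH above a height -/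

/-- FAR ∧ NEAR at the same width function `η` give "RH above height `max T₁ T₂`": the rate puts a high
zero inside the collar, the collar mechanism (`re_eq_half_of_monotoneOn`) puts it on the line. -/
theorem onLineAbove_of_rateBandW_of_collarMonoW {η : ℝ → ℝ} {T₁ T₂ : ℝ}
    (hR : RateBandW η T₁) (hC : CollarMonoW η T₂) : OnLineAbove (max T₁ T₂) := by
  intro s hz h0 h1 hT
  have hT₁ : T₁ ≤ |s.im| := le_trans (le_max_left _ _) hT.le
  have hT₂ : T₂ ≤ |s.im| := le_trans (le_max_right _ _) hT.le
  exact re_eq_half_of_monotoneOn (hC s.im hT₂) hz h0 h1 (hR s hz h0 h1 hT₁)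

/-- … hence the crux's definiens (stated UNFOLDED on purpose: only `CofiniteCriticalLine_of` below
concludes the crux by name), via GLUE 0 (`cofinite_iff_exists_onLineAbove` = the landed Negative lemma `cofiniteCriticalLine_iff_eventually_on_line`).
With `η t = C * t ^ (-ε)` this is the ideator's `firstLemma_holds`; with `η ≡ ε₀` it is the registered cut. -/
theorem offLine_finite_of_rateBandW_of_collarMonoW {η : ℝ → ℝ} {T₁ T₂ : ℝ}
    (hR : RateBandW η T₁) (hC : CollarMonoW η T₂) :
    {s : ℂ | riemannZeta s = 0 ∧ 0 < s.re ∧ s.re < 1 ∧ s.re ≠ 1 / 2}.Finite :=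
  cofinite_iff_exists_onLineAbove.2 ⟨_, onLineAbove_of_rateBandW_of_collarMonoW hR hC⟩

/-! ### §4 Constant junction: rung #4 is the FAR half at fixed width; glue for the lead -/

/-- Rung #4 `AsymptoticCriticalLine` (item stmt-RiemannHypothesis-2063) at the single width `ε₀` gives the
FAR half with constant width: the finitely many zeros at distance `≥ ε₀` from the line have bounded height. -/
theorem rateBandW_const_of_asymptotic (h4 : AsymptoticCriticalLine) {ε₀ : ℝ} (hε₀ : 0 < ε₀) :
    ∃ T₁ : ℝ, RateBandW (fun _ => ε₀) T₁ := by
  obtain ⟨M, hM⟩ := ((h4 ε₀ hε₀).image fun s : ℂ => |s.im|).bddAbove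
  refine ⟨M + 1, fun s hz h0 h1 hT => ?_⟩
  by_contra hlt
  have hmem : |s.im| ∈ (fun s : ℂ => |s.im|) ''
      {s : ℂ | riemannZeta s = 0 ∧ 0 < s.re ∧ s.re < 1 ∧ ε₀ ≤ |s.re - 1 / 2|} :=
    ⟨s, ⟨hz, h0, h1, (not_le.1 hlt).le⟩, rfl⟩
  have := hM hmem
  linarith

/-- GLUE 1 (triage r1-1/r1-2): the only property of the near stub the composition consumes —
fixed-collar monotonicity above `T` excludes zeros with `0 < |re s − 1/2| ≤ ε₀` above `T`. -/
theorem nearOnLine_of_fixedCollar {ε₀ T : ℝ} (hc : FixedCollar ε₀ T) : NearOnLine ε₀ T :=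
  fun s hz h0 h1 hT hX => re_eq_half_of_monotoneOn (hc s.im hT.le) hz h0 h1 hX

/-- GLUE 2: rung #4 plus "RH near the line above `T`" is "RH above some height". -/
theorem exists_onLineAbove_of_asymptotic_of_nearOnLine (h4 : AsymptoticCriticalLine) {ε₀ T : ℝ}
    (hε₀ : 0 < ε₀) (hN : NearOnLine ε₀ T) : ∃ T' : ℝ, OnLineAbove T' := by
  obtain ⟨T₁, hR⟩ := rateBandW_const_of_asymptotic h4 hε₀
  refine ⟨max T₁ T, fun s hz h0 h1 hT => ?_⟩
  have hT₁ : T₁ ≤ |s.im| := le_trans (le_max_left _ _) hT.le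
  have hT' : T < |s.im| := lt_of_le_of_lt (le_max_right _ _) hT
  exact hN s hz h0 h1 hT' (hR s hz h0 h1 hT₁)

/-- GLUE 3 (triage r1-1's `ScratchSplit`, re-proved): GIVEN rung #4, the crux is EQUIVALENT to
"RH near the line, eventually" at any one width `ε₀ > 0`.  So modulo `stub_far` the near stub carries
exactly `#5 ∖ #4`; its monotone phrasing is a choice of habitat (Sondow–Dumitrescu / Laguerre side),
not extra strength (triage r1-2). -/
theorem cofinite_iff_exists_nearOnLine_of_asymptotic (h4 : AsymptoticCriticalLine) {ε₀ : ℝ}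
    (hε₀ : 0 < ε₀) : CofiniteCriticalLine ↔ ∃ T : ℝ, NearOnLine ε₀ T := by
  constructor
  · intro h
    obtain ⟨T, hT⟩ := cofinite_iff_exists_onLineAbove.1 h
    exact ⟨T, fun s hz h0 h1 hT' _ => hT s hz h0 h1 hT'⟩
  · rintro ⟨T, hN⟩
    exact cofinite_iff_exists_onLineAbove.2
      (exists_onLineAbove_of_asymptotic_of_nearOnLine h4 hε₀ hN)

/-! ### §5 The two registered stubs (constant junction) -/

/-- **Stub FAR — rung #4 of the route, SHARED with item stmt-RiemannHypothesis-2063 (`RuelleBand.AsymptoticCriticalLine`,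
crux rank 4; the band engine's output: Faure–Tsujii asymptotic band / `BandRealisation → AsymptoticCriticalLine`).**
For every `ε > 0` only finitely many zeros of `ζ` in the open strip lie at distance `≥ ε` from the critical
line.  The line CONSUMES this item (it is not to be re-proved under this crux); it supplies the FAR half at
constant width (`rateBandW_const_of_asymptotic`).  Open problem; RH-implied; does not imply the crux
(`Negative.not_abstract_asymptotic_imp_cofinite`). -/
theorem stub_far : AsymptoticCriticalLine := by
  sorry

/-- **Stub NEAR — `#5 ∖ #4`: eventual fixed-collar monotonicity of `|ξ|` (cofinite Sondow–Dumitrescu /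
Matiyasevich–Saidak–Zvengrowski on a collar).** For ONE width `ε₀ > 0` and some height `T`: for every
`|t| ≥ T` the profile `x ↦ |ξ(1/2 + x + it)|` is nondecreasing on `[0, ε₀]`.  RH-implied (Hadamard product,
every factor increasing in `x`); crux-implied (exactness, `SplitExact`); does NOT imply the crux by itself
(far off-line zeros at generic heights leave a thin collar monotone: on-line curvature `Σₖ(t−γₖ)⁻² ~ log² t`
beats `2/a²`), and modulo `stub_far` it is equivalent to the crux (`cofinite_iff_exists_nearOnLine_of_asymptotic`
+ `nearOnLine_of_fixedCollar`).  Habitat: `|ξ(1/2+x+it)|² = Σₙ Lₙ(t) x^{2n}` (Csordas 2015 (2.11)); honest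
warning sharpened from triage: at collar widths `≍ κ/log t` every FINITE-order Laguerre domination criterion fails
infinitely often at close zero pairs (under RH for `κ > 0.52π`, under pair correlation for all `κ`), and all-orders
positivity is the crux again — a proof must be a positivity IDENTITY on the fixed collar, not an estimate.
Zero infimum margin (Lehmer pairs), never violated under RH (probe j008892, illustrative only: Σ₂ statement). -/
theorem stub_near :
    ∃ ε₀ : ℝ, 0 < ε₀ ∧ ∃ T : ℝ, ∀ t : ℝ, T ≤ |t| →
      MonotoneOn (fun x : ℝ => ‖riemannXi (1 / 2 + x + t * I)‖) (Set.Icc 0 ε₀) := by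
  sorry

/-! ### §6 The composition (concludes the crux BY NAME) -/

/-- **`CofiniteCriticalLine` from the two stubs.** `stub_near` gives a width `ε₀ > 0` and a height `T`
with fixed-collar monotonicity; `stub_far` at the width `ε₀` gives the FAR half with constant width
(`rateBandW_const_of_asymptotic`); the general composition at `η ≡ ε₀` gives RH above `max T₁ T`, and GLUE 0
turns "RH above a height" into the crux. Sorry-free apart from the two stubs. -/
theorem CofiniteCriticalLine_of : CofiniteCriticalLine := by
  obtain ⟨ε₀, hε₀, T, hT⟩ := stub_near
  obtain ⟨T₁, hR⟩ := rateBandW_const_of_asymptotic stub_far hε₀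
  have hC : CollarMonoW (fun _ => ε₀) T := fun t ht => hT t ht
  exact cofinite_iff_exists_onLineAbove.2
    ⟨max T₁ T, onLineAbove_of_rateBandW_of_collarMonoW hR hC⟩

/-! ### §7 Exactness and the other members of the family (documentation; not registered) -/

/-- EXACTNESS, far half (trivial direction, proved): the crux gives the FAR half for every nonnegative
width function. -/
theorem rateBandW_of_cofinite (h : CofiniteCriticalLine) {η : ℝ → ℝ} (hη : ∀ t, 0 ≤ η t) :
    ∃ T₁ : ℝ, RateBandW η T₁ := by
  obtain ⟨T, hT⟩ := cofinite_iff_exists_onLineAbove.1 h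
  refine ⟨T + 1, fun s hz h0 h1 hT₁ => ?_⟩
  rw [hT s hz h0 h1 (by linarith), sub_self, abs_zero]
  exact hη _

/-- EXACTNESS, near half (the converse `SplitExact` of the idea card; provable now, size M, from the tree's
Hadamard partial fraction `IsHadamardSeq.re_logDeriv_riemannXi_eq_tsum` + `re_inv_sub_eq`: above the last
off-line height `T₀ + 1/2` every on-line term `x/(x²+(t∓γ)²)` of `∂ₓ log|ξ(1/2+x+it)|` is `≥ 0` and each of
the finitely many off-line quadruples contributes `2x(x² − a² + D²)/(…) ≥ 0` since `D² ≥ 1/4 ≥ a²`; so the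
profile is nondecreasing on all of `[0, ∞)`, in particular on every fixed collar).  NOT a registered stub:
`CofiniteCriticalLine_of` does not consume it; it certifies that the cut loses nothing. -/
def SplitExact : Prop :=
  CofiniteCriticalLine → ∀ ε₀ : ℝ, 0 < ε₀ → ∃ T : ℝ, FixedCollar ε₀ T

/-- Polynomial junction (the ideator's `RateBand ε C` / `CollarMono ε C`): width `η t = C t^{-ε}`.
Would need an EFFECTIVE band engine (Faure–Tsujii remainder `O(ω^{-β/2})` for an exactly constant unstable
Jacobian — ungrounded reading, cheapest falsifier (a) of the card); implies rung #4 outright. -/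
def polyWidth (ε C : ℝ) : ℝ → ℝ := fun t => C * t ^ (-ε)

/-- Logarithmic junction: width `η t = κ / log t` — the universal tube scale at which every soft finiteness
mechanism and every finite-order Laguerre criterion stalls (obstruction notes B4/B6 of the ideator). -/
def logWidth (κ : ℝ) : ℝ → ℝ := fun t => κ / Real.log t

/-- The family is genuinely one composition: at any width function the two halves give the crux's definiens
(specialisation of `offLine_finite_of_rateBandW_of_collarMonoW`, recorded for the polynomial member). -/
theorem offLine_finite_of_poly {ε C T₁ T₂ : ℝ} (hR : RateBandW (polyWidth ε C) T₁)
    (hC : CollarMonoW (polyWidth ε C) T₂) :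
    {s : ℂ | riemannZeta s = 0 ∧ 0 < s.re ∧ s.re < 1 ∧ s.re ≠ 1 / 2}.Finite :=
  offLine_finite_of_rateBandW_of_collarMonoW hR hC

end Summit.RiemannHypothesis.RiemannHypothesis.Cruxes.CofiniteCriticalLine.RateBandCollarSplit
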